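import Summits.QuantumAdvantage.QuantumAdvantage.Theorems.ParityPinningB

/-! # ParityPinning — part 3/3 (mechanical split for landing of `ParityPinning`; content verbatim; scopes re-opened with their variables) -/

set_option linter.dupNamespace false -- D-0017: single-problem summit ⇒ `QuantumAdvantage.QuantumAdvantage` by design

namespace Summit.QuantumAdvantage.QuantumAdvantage.Theorems.PairFreezing
open Classical Finset Summit.QuantumAdvantage.AdviceFreeQNC0
open Literature.Computability.MetaComplexity Literature.Computability.MetaComplexity.Smolensky
open Literature.Computability.Complexity (parityFn)
open Summit.QuantumAdvantage.QuantumAdvantage.Theses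
variable {n : ℕ}

/-! ### §12 THE GEN-5 NODE «ParityPinning»: P2⁺⁺ splits along BALANCE; the balanced half is a THEOREM

Refines `PolyFeatureDial.FeatureRungPolyOdd` (item 28532 of the BORN route `route-QuantumAdvantage-PolyFeatureDial`,
= P2⁺⁺, the blocker of the feature-count dial) BY NAME:

  `FeatureRungPolyOdd ⟺ BalancedRungOdd ∧ PinningRungOdd`       (`featureRungPolyOdd_iff_pieces`, PROVED)

* `BalancedRungOdd`  [WEAKER: P2⁺⁺ restricted to feature maps all of whose cells are parity-balanced at a polylog
  scale; NECESSARY (`balancedRungOdd_of_poly`); **PROVED** (`balancedRungOdd_holds`, §11)].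
* `PinningRungOdd`   [P2⁺⁺ restricted to feature maps with an UNBALANCED ("parity-pinning") cell; NECESSARY; given the
  theorem above it is EQUIVALENT to P2⁺⁺ — DECLARED (critic test E): this is the RESIDUAL, now carrying exactly the
  unbalanced strategies; UNDECIDED; conjecturally VACUOUS: `pinningRungOdd_of_relSmol` (PROVED edge) — under the
  game-free law `RelSmolOdd` no polylog-degree cell is unbalanced at scale `(log₂ n)^{2C+2C'+1}`; TEST = the census
  extremiser hunt for `RelSmolensky` (KIT ASK 2026-08-30T05:47Z, prediction: sub-cube × residue readers extremal,
  threshold `≈ 1.12·q²`)].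
* LAW `RelSmolOdd := ∀ p ≥ 5, RelSmolensky p` [game-free, UNDECIDED, the ONE named input; edges PROVED:
  `RelSmolOdd → PinningRungOdd`, `RelSmolOdd → FeatureRungPolyOdd`, and with the route's residual
  `PolyFeatureShadow → RelSmolOdd → AdviceFreeQNC0Odd` (`closes_of_relSmol`)].

Leaf tags (D-0172): every statement here is RUNG CURRENCY for the leaf `AdviceFreeQNC0Odd` (F-Q1-odd) only —
[LEAF-ONLY → AdviceFreeQNC0Odd; root-path weight 0: no edge to `BQPNotSubsetBPP` is claimed or typed]. -/

section Node5

/-- **`BalancedRungOdd`** [piece 1 of P2⁺⁺; WEAKER; NECESSARY; PROVED]: `∀ p ≥ 5, WalkHardFFeatBal p`. -/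
def BalancedRungOdd : Prop := ∀ (p : ℕ) [Fact p.Prime], 5 ≤ p → WalkHardFFeatBal p

/-- PROVED (§11). -/
theorem balancedRungOdd_holds : BalancedRungOdd := fun p _ hp => walkHardFFeatBal_holds p (by omega)

/-- **`WalkHardFFeatPin p`** — P2⁺⁺ for feature maps with an UNBALANCED cell at scale `(log₂ n)^A`, the exponent `A`
chosen by the statement (`∃ A` after `C, C'`). -/
def WalkHardFFeatPin (p : ℕ) [Fact p.Prime] : Prop :=
  ∃ θ : ℝ, θ < 1 ∧ ∀ C C' : ℕ, ∃ A n₀ : ℕ, ∀ n ≥ n₀, ∀ K ≤ (Nat.log 2 n) ^ C', ∀ c : ℕ,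
    ∀ f : Fin K → (Fin n → Bool) → Bool, ∀ tab : Fin (n + 1) → (Fin K → Bool) → Bool,
    (∀ j, HasDegF p (f j) ((Nat.log 2 n) ^ C)) →
    (¬ ∀ v : Fin K → Bool, Balanced (fun u => decide ((fun j => f j u) = v)) ((Nat.log 2 n) ^ A)) →
      ((univ.filter fun u : Fin n → Bool =>
          ringWinU c (fun g u => tab g (fun j => f j u)) u = true).card : ℝ) ≤ θ * (2 : ℝ) ^ n

/-- **`PinningRungOdd`** [piece 2 of P2⁺⁺ = the RESIDUAL; NECESSARY; EQUIVALENT to P2⁺⁺ given `balancedRungOdd_holds`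
(declared); UNDECIDED; conjecturally VACUOUS (`pinningRungOdd_of_relSmol`)]. -/
def PinningRungOdd : Prop := ∀ (p : ℕ) [Fact p.Prime], 5 ≤ p → WalkHardFFeatPin p

/-- the law for the odd primes of the leaf. -/
def RelSmolOdd : Prop := ∀ (p : ℕ) [Fact p.Prime], 5 ≤ p → RelSmolensky p

/-- NECESSARY: P2⁺⁺ ⇒ the balanced piece (drop the balance hypothesis). -/
theorem balancedRungOdd_of_poly (h : PolyFeatureDial.FeatureRungPolyOdd) : BalancedRungOdd := by
  intro p _ hp
  obtain ⟨θ, hθ, H⟩ := h p hp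
  refine ⟨θ, hθ, fun C C' _ => ?_⟩
  obtain ⟨n₀, hn₀⟩ := H C C'
  exact ⟨n₀, fun n hn K hK c f tab hf _ => hn₀ n hn K hK c f tab hf⟩

/-- NECESSARY: P2⁺⁺ ⇒ the pinning piece (drop the unbalance hypothesis; `A := 0`). -/
theorem pinningRungOdd_of_poly (h : PolyFeatureDial.FeatureRungPolyOdd) : PinningRungOdd := by
  intro p _ hp
  obtain ⟨θ, hθ, H⟩ := h p hp
  refine ⟨θ, hθ, fun C C' => ?_⟩
  obtain ⟨n₀, hn₀⟩ := H C C'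
  exact ⟨0, n₀, fun n hn K hK c f tab hf _ => hn₀ n hn K hK c f tab hf⟩

/-- SUFFICIENT (the dichotomy): every feature map is balanced at the pinning piece's scale or it is not. -/
theorem featureRungPolyOdd_of_pieces (hB : BalancedRungOdd) (hP : PinningRungOdd) :
    PolyFeatureDial.FeatureRungPolyOdd := by
  intro p _ hp
  obtain ⟨θB, hθB, HB⟩ := hB p hp
  obtain ⟨θP, hθP, HP⟩ := hP p hp
  refine ⟨max θB θP, max_lt hθB hθP, fun C C' => ?_⟩
  obtain ⟨A, nP, hnP⟩ := HP C C'
  obtain ⟨nB, hnB⟩ := HB C C' A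
  refine ⟨max nB nP, fun n hn K hK c f tab hf => ?_⟩
  have h2n : (0 : ℝ) ≤ (2 : ℝ) ^ n := by positivity
  by_cases hbal : ∀ v : Fin K → Bool, Balanced (fun u => decide ((fun j => f j u) = v)) ((Nat.log 2 n) ^ A)
  · exact (hnB n (le_of_max_le_left hn) K hK c f tab hf hbal).trans
      (mul_le_mul_of_nonneg_right (le_max_left _ _) h2n)
  · exact (hnP n (le_of_max_le_right hn) K hK c f tab hf hbal).trans
      (mul_le_mul_of_nonneg_right (le_max_right _ _) h2n)

/-- **THE NODE**: `P2⁺⁺ ⟺ BalancedRungOdd ∧ PinningRungOdd` (PROVED). -/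
theorem featureRungPolyOdd_iff_pieces :
    PolyFeatureDial.FeatureRungPolyOdd ↔ (BalancedRungOdd ∧ PinningRungOdd) :=
  ⟨fun h => ⟨balancedRungOdd_of_poly h, pinningRungOdd_of_poly h⟩,
    fun h => featureRungPolyOdd_of_pieces h.1 h.2⟩

/-- DECLARED EQUIVALENCE (critic test E): with the balanced half PROVED, the residual IS P2⁺⁺ restricted to unbalanced
feature maps and is equivalent to P2⁺⁺. -/
theorem featureRungPolyOdd_iff_pinning : PolyFeatureDial.FeatureRungPolyOdd ↔ PinningRungOdd :=
  ⟨pinningRungOdd_of_poly, fun h => featureRungPolyOdd_of_pieces balancedRungOdd_holds h⟩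

/-- arithmetic for the vacuity edge: `A·(d+1)² ≤ ℓ^{2(C+C')+1}` once `d ≤ ℓ^{C+C'}` and `4A ≤ ℓ`. -/
theorem relScale_le {A ℓ C₂ d : ℕ} (hℓ : 4 * A ≤ ℓ) (hℓ1 : 1 ≤ ℓ) (hd : d ≤ ℓ ^ C₂) :
    A * (d + 1) ^ 2 ≤ ℓ ^ (2 * C₂ + 1) := by
  have hP : 1 ≤ ℓ ^ C₂ := Nat.one_le_pow _ _ hℓ1
  have hd1 : d + 1 ≤ 2 * ℓ ^ C₂ := by omega
  have hsq : (d + 1) ^ 2 ≤ 4 * (ℓ ^ C₂) ^ 2 := by nlinarith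
  calc A * (d + 1) ^ 2 ≤ A * (4 * (ℓ ^ C₂) ^ 2) := Nat.mul_le_mul_left _ hsq
    _ = (4 * A) * (ℓ ^ C₂) ^ 2 := by ring
    _ ≤ ℓ * (ℓ ^ C₂) ^ 2 := Nat.mul_le_mul_right _ hℓ
    _ = ℓ ^ (2 * C₂ + 1) := by ring

/-- **edge LAW ⇒ RESIDUAL (vacuity)**: under `RelSmolOdd` every cell of a polylog-degree feature map is balanced at
scale `(log₂ n)^{2(C+C')+1}` (cells have degree `K·(log₂ n)^C ≤ (log₂ n)^{C+C'}`, `hasDegF_pattern`-style), so the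
pinning piece has NO instances: PROVED. -/
theorem pinningRungOdd_of_relSmol (h : RelSmolOdd) : PinningRungOdd := by
  intro p _ hp
  obtain ⟨A, hA⟩ := h p hp
  refine ⟨0, by norm_num, fun C C' => ⟨2 * (C + C') + 1, 2 ^ (4 * A + 1), fun n hn K hK c f tab hf hnb => ?_⟩⟩
  exfalso
  apply hnb
  intro v
  have h2n : 2 ^ (4 * A + 1) ≤ n := hn
  have hℓ : 4 * A + 1 ≤ Nat.log 2 n := Nat.le_log_of_pow_le (by norm_num) h2n
  have hℓ1 : 1 ≤ Nat.log 2 n := by omega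
  -- the cell `{f⃗ = v}` has degree `K·(log₂ n)^C ≤ (log₂ n)^{C+C'}`
  have hdegv : HasDegF p (fun u => decide ((fun j => f j u) = v)) ((Nat.log 2 n) ^ (C + C')) := by
    unfold HasDegF
    have h := GapFibre.ind_mem_lowDeg_of_pattern (F := ZMod p) (L := n) (D := (Nat.log 2 n) ^ C)
      (univ : Finset (Fin K)) (fun j u => f j u) (fun j _ => hf j) (fun u => decide ((fun j => f j u) = v))
      (fun z z' hzz' => by
        have : (fun j => f j z) = (fun j => f j z') := funext fun j => hzz' j (mem_univ j)
        simp only [this])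
    rw [Finset.card_univ, Fintype.card_fin] at h
    refine lowDeg_mono ?_ h
    calc K * (Nat.log 2 n) ^ C ≤ (Nat.log 2 n) ^ C' * (Nat.log 2 n) ^ C := Nat.mul_le_mul_right _ hK
      _ = (Nat.log 2 n) ^ (C + C') := by ring
  exact balanced_of_relSmolensky hA (relScale_le (by omega) hℓ1 le_rfl) hdegv

/-- **edge LAW ⇒ P2⁺⁺** (PROVED): relative Smolensky for the odd primes `p ≥ 5` gives the polylog feature rung. -/
theorem featureRungPolyOdd_of_relSmol (h : RelSmolOdd) : PolyFeatureDial.FeatureRungPolyOdd :=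
  featureRungPolyOdd_of_pieces balancedRungOdd_holds (pinningRungOdd_of_relSmol h)

/-- the route's glue item 28534 `PolyPiecesGlue` BY NAME (PROVED; g4's `target_of_polyPieces` over the tree names):
P1⁺⁺ → P2⁺⁺ → Target, `θ := max (θ₀ + (1−θ₀)/4) (1 − ε)`. -/
theorem polyPiecesGlue_holds : PolyFeatureDial.PolyPiecesGlue := by
  intro h₁ h₂ p _ hp
  obtain ⟨θ₀, hθ₀, H₂⟩ := h₂ p hp
  have hq : 0 < (1 - θ₀) / 4 := by linarith
  obtain ⟨ε, hε, H₁⟩ := h₁ p hp ((1 - θ₀) / 4) hq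
  refine ⟨max (θ₀ + (1 - θ₀) / 4) (1 - ε), max_lt (by linarith) (by linarith), fun C => ?_⟩
  obtain ⟨C', C'', n₁, H₁C⟩ := H₁ C
  obtain ⟨n₂, H₂C⟩ := H₂ C' C''
  refine ⟨max n₁ n₂, fun n hn c y hy => ?_⟩
  have h2 : (0 : ℝ) ≤ (2 : ℝ) ^ n := by positivity
  by_cases hwin : ((Finset.univ.filter fun u : Fin n → Bool => ringWinU c y u = true).card : ℝ) ≤ (1 - ε) * (2 : ℝ) ^ n
  · exact hwin.trans (mul_le_mul_of_nonneg_right (le_max_right _ _) h2)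
  · rw [not_le] at hwin
    obtain ⟨K, hK, f, hf, tab, hExc⟩ := H₁C n (le_of_max_le_left hn) c y hy hwin.le
    have hmodel := H₂C n (le_of_max_le_right hn) K hK c f tab hf
    set Exc := Finset.univ.filter fun u : Fin n → Bool => ¬ (∀ e ∈ Finset.range 3, ∀ e' ∈ Finset.range 3,
            ((Finset.univ.filter fun g : Fin (n + 1) => y g u = true ∧ (g.val + wtPrefix u g.val) % 3 = e).card
              + (Finset.univ.filter fun g : Fin (n + 1) =>
                  tab g (fun j => f j u) = true ∧ (g.val + wtPrefix u g.val) % 3 = e).card) % 2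
            = ((Finset.univ.filter fun g : Fin (n + 1) => y g u = true ∧ (g.val + wtPrefix u g.val) % 3 = e').card
              + (Finset.univ.filter fun g : Fin (n + 1) =>
                  tab g (fun j => f j u) = true ∧ (g.val + wtPrefix u g.val) % 3 = e').card) % 2) with hExcDef
    set WinM := Finset.univ.filter fun u : Fin n → Bool => ringWinU c (fun g u => tab g (fun j => f j u)) u = true
      with hWinMDef
    have hsub : (Finset.univ.filter fun u : Fin n → Bool => ringWinU c y u = true) ⊆ Exc ∪ WinM := by
      intro u hu
      rw [mem_filter] at hu
      rw [mem_union]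
      by_cases hE : u ∈ Exc
      · exact Or.inl hE
      · right
        rw [hExcDef, mem_filter, not_and, not_not] at hE
        have hX := hE (mem_univ _)
        rw [hWinMDef, mem_filter]
        refine ⟨mem_univ _, ?_⟩
        rw [← FeatureShadowClosing.ringWinU_eq_of_shadow c y (fun g u => tab g (fun j => f j u)) u hX]
        exact hu.2
    have hle := (Finset.card_le_card hsub).trans (Finset.card_union_le _ _)
    have hle' : (((Finset.univ.filter fun u : Fin n → Bool => ringWinU c y u = true).card : ℕ) : ℝ)
        ≤ (Exc.card : ℝ) + (WinM.card : ℝ) := by exact_mod_cast hle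
    calc (((Finset.univ.filter fun u : Fin n → Bool => ringWinU c y u = true).card : ℕ) : ℝ)
        ≤ (Exc.card : ℝ) + (WinM.card : ℝ) := hle'
      _ ≤ (1 - θ₀) / 4 * (2 : ℝ) ^ n + θ₀ * (2 : ℝ) ^ n := add_le_add hExc hmodel
      _ = (θ₀ + (1 - θ₀) / 4) * (2 : ℝ) ^ n := by ring
      _ ≤ max (θ₀ + (1 - θ₀) / 4) (1 - ε) * (2 : ℝ) ^ n := mul_le_mul_of_nonneg_right (le_max_left _ _) h2

/-- the route's deciding chain with the residual replaced by the pinning piece, through the TREE's `closes`: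
`PolyFeatureShadow (28533) → PinningRungOdd → AdviceFreeQNC0Odd`. -/
theorem closes_of_pinning (h₁ : PolyFeatureDial.PolyFeatureShadow) (h₂ : PinningRungOdd) : AdviceFreeQNC0Odd :=
  PolyFeatureDial.closes h₁ (featureRungPolyOdd_iff_pinning.2 h₂) polyPiecesGlue_holds

/-- … and with the law: `PolyFeatureShadow → RelSmolOdd → AdviceFreeQNC0Odd`. -/
theorem closes_of_relSmol (h₁ : PolyFeatureDial.PolyFeatureShadow) (h₂ : RelSmolOdd) : AdviceFreeQNC0Odd :=
  closes_of_pinning h₁ (pinningRungOdd_of_relSmol h₂)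

end Node5

/-! ### §13 A certified sub-family: LOCAL feature maps are balanced — `WalkHardLocal` PROVED unconditionally

The balance hypothesis of §11 is met, with exact balance, by every level set that ignores one of the free
variables: juntas.  Hence strategies that READ AT MOST `(log₂ n)^A` INPUT BITS — tables, potential support and shot
counts arbitrary, `K = #S` up to any polylog (far beyond the `log₂ n / 7` of §9, and outside the shots / sparse rungs) —
lose α's u-walk game on a constant fraction of inputs.  This is the unconditional reach of the balanced piece. -/

section Local

variable {n : ℕ}

/-- flipping one bit flips the parity. -/
theorem parityFn_update_not {m : ℕ} (z : Fin m → Bool) (k : Fin m) :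
    parityFn m (Function.update z k (!z k)) = !parityFn m z := by
  have hS : (univ.filter fun i => Function.update z k (!z k) i = true) =
      if z k = true then (univ.filter fun i => z i = true).erase k
      else insert k (univ.filter fun i => z i = true) := by
    split_ifs with h0
    · ext i
      rw [mem_erase, mem_filter, mem_filter]
      by_cases hi : i = k
      · subst hi; simp [h0]
      · simp [hi]
    · ext i
      rw [mem_insert, mem_filter, mem_filter]
      by_cases hi : i = k
      · subst hi; simp [h0]
      · simp [hi]
  unfold parityFn Literature.Computability.Complexity.GateFn.numOnes
  rw [hS]
  split_ifs with h0
  · have hmem : k ∈ (univ.filter fun i => z i = true) := by rw [mem_filter]; exact ⟨mem_univ _, h0⟩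
    rw [card_erase_of_mem hmem]
    have hpos := card_pos.2 ⟨k, hmem⟩
    rcases Nat.mod_two_eq_zero_or_one (univ.filter fun i => z i = true).card with h | h
    · have h' : ((univ.filter fun i => z i = true).card - 1) % 2 = 1 := by omega
      rw [h, h']; decide
    · have h' : ((univ.filter fun i => z i = true).card - 1) % 2 = 0 := by omega
      rw [h, h']; decide
  · have hmem : k ∉ (univ.filter fun i => z i = true) := by rw [mem_filter]; simp [h0]
    rw [card_insert_of_notMem hmem]
    rcases Nat.mod_two_eq_zero_or_one (univ.filter fun i => z i = true).card with h | h
    · have h' : ((univ.filter fun i => z i = true).card + 1) % 2 = 1 := by omega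
      rw [h, h']; decide
    · have h' : ((univ.filter fun i => z i = true).card + 1) % 2 = 0 := by omega
      rw [h, h']; decide

/-- `g` reads only the coordinates in `S` (an `S`-junta). -/
def DependsOn (g : (Fin n → Bool) → Bool) (S : Finset (Fin n)) : Prop :=
  ∀ u u' : Fin n → Bool, (∀ j ∈ S, u j = u' j) → g u = g u'

/-- **juntas are balanced**, exactly: on a literal cube of dimension `m > #S` some free variable is read by no
coordinate of `S`; flipping it is a parity-switching involution of the level set. -/
theorem balanced_of_dependsOn {g : (Fin n → Bool) → Bool} {S : Finset (Fin n)} (hS : DependsOn g S) {M : ℕ}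
    (hM : S.card < M) : Balanced g M := by
  intro m hm E hE
  -- the free variables read by the coordinates of `S`
  set t : Fin n → Finset (Fin m) := fun j =>
    univ.filter fun k => ∃ z, E (Function.update z k (!z k)) j ≠ E z j with ht
  have ht1 : ∀ j, (t j).card ≤ 1 := by
    intro j
    obtain ⟨b, hb⟩ := hE j
    refine Finset.card_le_one.2 fun k hk k' hk' => ?_
    rw [ht, mem_filter] at hk hk'
    obtain ⟨z, hz⟩ := hk.2
    obtain ⟨z', hz'⟩ := hk'.2
    rcases hb with hconst | ⟨k₁, hk₁⟩
    · exact absurd ((hconst _).trans (hconst z).symm) hz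
    · have e1 : k = k₁ := by
        by_contra hne
        apply hz
        rw [hk₁, hk₁, Function.update_of_ne (Ne.symm hne)]
      have e2 : k' = k₁ := by
        by_contra hne
        apply hz'
        rw [hk₁, hk₁, Function.update_of_ne (Ne.symm hne)]
      rw [e1, e2]
  set T : Finset (Fin m) := S.biUnion t with hT
  have hTcard : T.card ≤ S.card :=
    calc T.card ≤ ∑ j ∈ S, (t j).card := card_biUnion_le
      _ ≤ ∑ j ∈ S, 1 := sum_le_sum fun j _ => ht1 j
      _ = S.card := by simp
  have hlt : T.card < (univ : Finset (Fin m)).card := by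
    rw [card_univ, Fintype.card_fin]; omega
  obtain ⟨k₀, -, hk₀⟩ := Finset.exists_mem_notMem_of_card_lt_card hlt
  have hfix : ∀ j ∈ S, ∀ z, E (Function.update z k₀ (!z k₀)) j = E z j := by
    intro j hj z
    by_contra h
    exact hk₀ (mem_biUnion.2 ⟨j, hj, by rw [ht, mem_filter]; exact ⟨mem_univ _, z, h⟩⟩)
  set φ : (Fin m → Bool) → (Fin m → Bool) := fun z => Function.update z k₀ (!z k₀) with hφ
  have hφφ : ∀ z, φ (φ z) = z := by
    intro z; funext i
    by_cases hi : i = k₀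
    · subst hi; simp [hφ]
    · simp [hφ, hi]
  have hg : ∀ z, g (E (φ z)) = g (E z) := fun z => hS _ _ fun j hj => hfix j hj z
  have hpar : ∀ z, parityFn m (φ z) = !parityFn m z := fun z => parityFn_update_not z k₀
  have hle : ∀ b : Bool, (univ.filter fun z : Fin m → Bool => g (E z) = true ∧ parityFn m z = b).card ≤
      (univ.filter fun z : Fin m → Bool => g (E z) = true ∧ parityFn m z = !b).card := by
    intro b
    refine Finset.card_le_card_of_injOn φ (fun z hz => ?_) (fun z _ z' _ h => ?_)
    · rw [mem_coe, mem_filter] at hz ⊢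
      exact ⟨mem_univ _, by rw [hg]; exact hz.2.1, by rw [hpar, hz.2.2]⟩
    · rw [← hφφ z, h, hφφ]
  have h1 := hle true
  have h2 := hle false
  simp only [Bool.not_true, Bool.not_false] at h1 h2
  exact ⟨by omega, by omega⟩

/-- **`WalkHardLocal`** (prime-free: the u-walk game itself does not see `p`): strategies that READ AT MOST
`(log₂ n)^A` INPUT BITS win α's u-walk game on at most `θ·2ⁿ` inputs, one `θ < 1` for all `A`. -/
def WalkHardLocal : Prop :=
  ∃ θ : ℝ, θ < 1 ∧ ∀ A : ℕ, ∃ n₀ : ℕ, ∀ n ≥ n₀, ∀ S : Finset (Fin n), S.card ≤ (Nat.log 2 n) ^ A →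
    ∀ c : ℕ, ∀ y : Fin (n + 1) → (Fin n → Bool) → Bool, (∀ g, DependsOn (y g) S) →
      ((univ.filter fun u : Fin n → Bool => ringWinU c y u = true).card : ℝ) ≤ θ * (2 : ℝ) ^ n

/-- **THEOREM.** `WalkHardLocal`: read the `#S ≤ (log₂ n)^A` bits as `#S` literal features (degree `1 = (log₂ n)^0`);
their cells are `S`-juntas, balanced at scale `(log₂ n)^{A+1} > #S` (`balanced_of_dependsOn`); apply
`walkHardFFeatBal_holds` at the prime `5`. -/
theorem walkHardLocal_holds : WalkHardLocal := by
  haveI : Fact (Nat.Prime 5) := ⟨by norm_num⟩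
  obtain ⟨θ, hθ, H⟩ := walkHardFFeatBal_holds 5 (by norm_num)
  refine ⟨θ, hθ, fun A => ?_⟩
  obtain ⟨n₀, hn₀⟩ := H 0 A (A + 1)
  refine ⟨max n₀ 4, fun n hn S hS c y hy => ?_⟩
  have hn0 : n₀ ≤ n := le_trans (le_max_left _ _) hn
  have hn4 : 4 ≤ n := le_trans (le_max_right _ _) hn
  have hℓ2 : 2 ≤ Nat.log 2 n := Nat.le_log_of_pow_le (by norm_num) (by simpa using hn4)
  -- the literal features and the table of the local strategy
  set K : ℕ := S.card with hKdef
  set ι : Fin K ≃o {x // x ∈ S} := S.orderIsoOfFin rfl with hι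
  set f : Fin K → (Fin n → Bool) → Bool := fun j u => u (ι j).1 with hf
  set ext : (Fin K → Bool) → (Fin n → Bool) := fun v i => if h : i ∈ S then v (ι.symm ⟨i, h⟩) else false with hext
  set tab : Fin (n + 1) → (Fin K → Bool) → Bool := fun g v => y g (ext v) with htab
  have hyeq : y = fun g u => tab g (fun j => f j u) := by
    funext g u
    refine hy g u (ext fun j => f j u) fun j hj => ?_
    simp only [hext, hf, dif_pos hj]
    rw [OrderIso.apply_symm_apply]
  rw [hyeq]
  refine hn₀ n hn0 K hS c f tab (fun j => ?_) (fun v => ?_)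
  · -- degree `1 = (log₂ n)^0`
    unfold HasDegF
    rw [pow_zero]
    have hmono : mono (ZMod 5) ({(ι j).1} : Finset (Fin n)) = fun u => if f j u = true then (1 : ZMod 5) else 0 := by
      funext u; unfold mono; rw [prod_singleton]
    rw [← hmono]
    exact mono_mem_lowDeg (by rw [card_singleton])
  · -- the cell `{f⃗ = v}` is an `S`-junta
    refine balanced_of_dependsOn (S := S) (fun u u' huu' => ?_) ?_
    · have : (fun j => f j u) = (fun j => f j u') := funext fun j => by
        simp only [hf]; exact huu' _ (ι j).2
      simp only [this]
    · calc S.card ≤ Nat.log 2 n ^ A := hS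
        _ < Nat.log 2 n ^ (A + 1) := Nat.pow_lt_pow_right (by omega) (by omega)

end Local

end Summit.QuantumAdvantage.QuantumAdvantage.Theorems.PairFreezing
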